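import Summits.CriticalPhenomena.PercolationContinuityZ3.Theorems.PercAnnulusCrossingSymmetricSharpThresholdTorus
import Literature.Probability.Percolation.SubgraphMonotonicity
import Summits.CriticalPhenomena.PercolationContinuityZ3.Theorems.FK.ContinuityQOneBridge
import HarnessLib

/-!
# RSW3 lane (lead, gen 24): SYMMETRY AND SHARP THRESHOLDS, III — the periodic lift: events of `ℤ^d` read on the
# torus `(ℤ/Lℤ)^d` at a base point, their translation covariance, and the invariant union of all translates

builds on p205010 (kernel theorem, internal audit signed; external expert review pending) — NOT used in this file
(every `d`, `L`, every event).

Cell `prim-rsw3` (LANE 3), lead seat, gen 24.  Support file (`--supports stmt-CriticalPhenomena-4575`); no definitions,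
no named facts, no sorries.  To apply part II (Friedgut–Kalai on the torus) to BOX CROSSINGS one symmetrises
(Bollobás–Riordan 2006, Ch. 3, proof of Lemma 8): a torus configuration `ω_T` is read at the base point `t ∈ (ℤ/Lℤ)^d`
through the PERIODIC LIFT `Λ_t(ω_T) = {e ∈ E(ℤ^d) | π(e) + t ∈ ω_T}` (`π : ℤ^d → (ℤ/Lℤ)^d` the projection `Torus.proj`;
in the tree's vocabulary `Λ_t(ω_T) = restrictConfig (x ↦ π x + t) ω_T ∩ E(ℤ^d)`), and an event `A` of `ℤ^d` becomes
the torus event `Λ_t⁻¹(A)` "A happens around `t`".  This file is the calculus of `Λ_t` (written inline, no definitions):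

* `restrictConfig_inter`, `restrictConfig_mono`, `restrictConfig_shift_edgeSet` — algebra of `restrictConfig` (intersections,
  monotonicity, shift invariance of `E(ℤ^d)`; composition is the tree's `FK.restrictConfig_restrictConfig`);
* `proj_single`, `torusGraph_adj_proj_of_adj` — `π(e_j) = e_j`, and (for `L ≥ 2`) `π` maps lattice edges to torus edges;
* **`lift_relabel_torusTranslate`** — TRANSLATION COVARIANCE: `Λ_t(ω_T + u) = Λ_{t−u}(ω_T)`;
* **`lift_shift`** — `restrictConfig (· + s) (Λ_t ω_T) = Λ_{t + π s}(ω_T)`: shifting the lifted configuration by `s ∈ ℤ^d`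
  moves the base point by `π s`;
* `lift_inter_edgeSet` — `Λ_t(ω_T) = Λ_t(ω_T ∩ E(T))` (`L ≥ 2`): the lift only reads torus edges;
* **`isUpperSet_preimage_lift`**, **`determinedBy_preimage_lift`**, **`measurableSet_preimage_lift`** — `Λ_t⁻¹(A)` is
  increasing / determined by `E(T)` / measurable when `A` is increasing / arbitrary / measurable;
* **`relabel_preimage_iUnion_lift`** — THE SYMMETRISED EVENT `⋃_t Λ_t⁻¹(A)` IS INVARIANT UNDER EVERY TRANSLATION OF THE TORUS
  (with `isUpperSet_iUnion_lift`, `determinedBy_iUnion_lift`, `measurableSet_iUnion_lift`): exactly the hypotheses of part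
  II's `torus_one_sub_le_real(_rpow)`.

References: B. Bollobás, O. Riordan, *Percolation* (CUP 2006), Ch. 3, Lemma 8 (symmetrisation on the torus);
E. Friedgut, G. Kalai, Proc. AMS 124 (1996) §3; G. Grimmett, *Percolation* (1999) §1.6 (invariance of `P_p`).
-/

noncomputable section

namespace Summit.CriticalPhenomena.PercolationContinuityZ3.Theorems.Crossing

open MeasureTheory Literature.Probability.LatticeModels Literature.Probability.Percolation SimpleGraph
open Literature.Probability.Percolation.GhostField (torusTranslate)
open Summit.CriticalPhenomena.PercolationContinuityZ3.Theorems.FK (restrictConfig_restrictConfig)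

variable {d L : ℕ}

/-! ## §1 Algebra of `restrictConfig` -/

/-- `restrictConfig f (ω ∩ ω') = restrictConfig f ω ∩ restrictConfig f ω'`. [folklore] -/
theorem restrictConfig_inter {V W : Type*} (f : W → V) (ω ω' : BondConfig V) :
    restrictConfig f (ω ∩ ω') = restrictConfig f ω ∩ restrictConfig f ω' := by
  ext e
  simp only [mem_restrictConfig, Set.mem_inter_iff]

/-- `restrictConfig f` is monotone. [folklore] -/
theorem restrictConfig_mono {V W : Type*} (f : W → V) {ω ω' : BondConfig V} (h : ω ⊆ ω') :
    restrictConfig f ω ⊆ restrictConfig f ω' := fun _ he => h he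

/-- Adjacency of `ℤ^d` is translation invariant: `x + s ∼ y + s ↔ x ∼ y`. [folklore] -/
theorem zdGraph_adj_add_right_iff (s x y : Site d) : (zdGraph d).Adj (x + s) (y + s) ↔ (zdGraph d).Adj x y := by
  rw [zdGraph_adj_iff, zdGraph_adj_iff]
  refine exists_congr fun i => ?_
  constructor
  · rintro (h | h)
    · left; rw [add_right_comm] at h; exact add_right_cancel h
    · right; rw [add_right_comm] at h; exact add_right_cancel h
  · rintro (h | h)
    · left; rw [h]; abel
    · right; rw [h]; abel

/-- The edge set of `ℤ^d` is shift invariant: `restrictConfig (· + s) E(ℤ^d) = E(ℤ^d)`. [folklore] -/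
theorem restrictConfig_shift_edgeSet (s : Site d) :
    restrictConfig (fun x : Site d => x + s) (zdGraph d).edgeSet = (zdGraph d).edgeSet := by
  ext e
  induction e using Sym2.ind with
  | h x y => simp only [mem_restrictConfig, Sym2.map_mk, SimpleGraph.mem_edgeSet, zdGraph_adj_add_right_iff]

/-! ## §2 The projection `π : ℤ^d → (ℤ/Lℤ)^d` -/

/-- `π(e_j) = e_j`. [folklore] -/
theorem proj_single (j : Fin d) : Torus.proj L (Pi.single j (1 : ℤ)) = Pi.single j (1 : ZMod L) := by
  funext i
  by_cases h : i = j
  · subst h; simp [Torus.proj]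
  · simp [Torus.proj, Pi.single_eq_of_ne h]

/-- **`π` maps lattice edges to torus edges** (`L ≥ 2`): `x ∼ y` in `ℤ^d` ⇒ `π x + t ∼ π y + t` in `(ℤ/Lℤ)^d`. [folklore] -/
theorem torusGraph_adj_proj_of_adj (hL : 2 ≤ L) (t : TorusSite d L) {x y : Site d} (h : (zdGraph d).Adj x y) :
    (torusGraph d L).Adj (Torus.proj L x + t) (Torus.proj L y + t) := by
  have proj_add : ∀ x y : Site d, Torus.proj L (x + y) = Torus.proj L x + Torus.proj L y := fun x y => by
    funext i; simp [Torus.proj, Int.cast_add]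
  have single_one_ne_zero_zmod : ∀ j : Fin d, (Pi.single j (1 : ZMod L) : TorusSite d L) ≠ 0 := by
    intro j h
    have h1 := congrFun h j
    simp only [Pi.single_eq_same, Pi.zero_apply] at h1
    haveI : Fact (1 < L) := ⟨by omega⟩
    exact one_ne_zero h1
  rw [torusGraph_adj_iff]
  rw [zdGraph_adj_iff] at h
  obtain ⟨j, hj | hj⟩ := h
  · have key : Torus.proj L y + t = Torus.proj L x + t + Pi.single j 1 := by
      rw [hj, proj_add, proj_single]; abel
    refine ⟨?_, Or.inl ⟨j, key⟩⟩
    intro heq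
    rw [heq] at key
    have : (Pi.single j (1 : ZMod L) : TorusSite d L) = 0 := by
      have := congrArg (· - (Torus.proj L y + t)) key
      simpa using this.symm
    exact single_one_ne_zero_zmod j this
  · have key : Torus.proj L x + t = Torus.proj L y + t + Pi.single j 1 := by
      rw [hj, proj_add, proj_single]; abel
    refine ⟨?_, Or.inr ⟨j, key⟩⟩
    intro heq
    rw [← heq] at key
    have : (Pi.single j (1 : ZMod L) : TorusSite d L) = 0 := by
      have := congrArg (· - (Torus.proj L x + t)) key
      simpa using this.symm
    exact single_one_ne_zero_zmod j this

/-! ## §3 The periodic lift `Λ_t(ω_T) = restrictConfig (x ↦ π x + t) ω_T ∩ E(ℤ^d)` -/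

/-- **TRANSLATION COVARIANCE OF THE LIFT**: `Λ_t(ω_T + u) = Λ_{t − u}(ω_T)`. [cite: BollobasRiordan2006, Ch. 3, Lemma 8 (proof)] -/
theorem lift_relabel_torusTranslate (t u : TorusSite d L) (ω : BondConfig (TorusSite d L)) :
    restrictConfig (fun x : Site d => Torus.proj L x + t) (BondConfig.relabel (sym2Equiv (torusTranslate u).toEquiv) ω)
        ∩ (zdGraph d).edgeSet =
      restrictConfig (fun x : Site d => Torus.proj L x + (t - u)) ω ∩ (zdGraph d).edgeSet := by
  congr 1
  ext e
  induction e using Sym2.ind with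
  | h x y =>
    simp only [mem_restrictConfig, Sym2.map_mk, BondConfig.mem_relabel_iff, sym2Equiv_symm, sym2Equiv_mk]
    have h1 : (torusTranslate u).toEquiv.symm (Torus.proj L x + t) = Torus.proj L x + (t - u) := by
      show Torus.proj L x + t + -u = _
      abel
    have h2 : (torusTranslate u).toEquiv.symm (Torus.proj L y + t) = Torus.proj L y + (t - u) := by
      show Torus.proj L y + t + -u = _
      abel
    rw [h1, h2]

/-- **THE LIFT AND LATTICE SHIFTS**: `restrictConfig (· + s) (Λ_t ω_T) = Λ_{t + π s}(ω_T)` for `s ∈ ℤ^d`. [folklore] -/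
theorem lift_shift (t : TorusSite d L) (s : Site d) (ω : BondConfig (TorusSite d L)) :
    restrictConfig (fun x : Site d => x + s)
        (restrictConfig (fun x : Site d => Torus.proj L x + t) ω ∩ (zdGraph d).edgeSet) =
      restrictConfig (fun x : Site d => Torus.proj L x + (t + Torus.proj L s)) ω ∩ (zdGraph d).edgeSet := by
  rw [restrictConfig_inter, restrictConfig_restrictConfig, restrictConfig_shift_edgeSet]
  congr 1
  ext e
  simp only [mem_restrictConfig]
  have proj_add : ∀ x y : Site d, Torus.proj L (x + y) = Torus.proj L x + Torus.proj L y := fun x y => by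
    funext i; simp [Torus.proj, Int.cast_add]
  have : ((fun x : Site d => Torus.proj L x + t) ∘ fun x : Site d => x + s) =
      fun x : Site d => Torus.proj L x + (t + Torus.proj L s) := by
    funext x
    simp only [Function.comp_apply, proj_add]
    abel
  rw [this]

/-- The lift is monotone in the torus configuration. [folklore] -/
theorem lift_mono (t : TorusSite d L) {ω ω' : BondConfig (TorusSite d L)} (h : ω ⊆ ω') :
    restrictConfig (fun x : Site d => Torus.proj L x + t) ω ∩ (zdGraph d).edgeSet ⊆
      restrictConfig (fun x : Site d => Torus.proj L x + t) ω' ∩ (zdGraph d).edgeSet :=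
  Set.inter_subset_inter_left _ (restrictConfig_mono _ h)

/-- **The lift only reads torus edges** (`L ≥ 2`): `Λ_t(ω_T) = Λ_t(ω_T ∩ E(T))`. [folklore] -/
theorem lift_inter_edgeSet (hL : 2 ≤ L) (t : TorusSite d L) (ω : BondConfig (TorusSite d L)) :
    restrictConfig (fun x : Site d => Torus.proj L x + t) ω ∩ (zdGraph d).edgeSet =
      restrictConfig (fun x : Site d => Torus.proj L x + t) (ω ∩ (torusGraph d L).edgeSet) ∩ (zdGraph d).edgeSet := by
  ext e
  induction e using Sym2.ind with
  | h x y =>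
    simp only [Set.mem_inter_iff, mem_restrictConfig, Sym2.map_mk, SimpleGraph.mem_edgeSet]
    constructor
    · rintro ⟨h1, h2⟩
      exact ⟨⟨h1, torusGraph_adj_proj_of_adj hL t h2⟩, h2⟩
    · rintro ⟨⟨h1, -⟩, h2⟩
      exact ⟨h1, h2⟩

/-- The lift is a measurable map. [folklore] -/
theorem measurable_lift (t : TorusSite d L) :
    Measurable fun ω : BondConfig (TorusSite d L) =>
      restrictConfig (fun x : Site d => Torus.proj L x + t) ω ∩ (zdGraph d).edgeSet := by
  refine measurable_set_iff.2 fun e => ?_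
  have h1 : Measurable fun ω : BondConfig (TorusSite d L) =>
      e ∈ restrictConfig (fun x : Site d => Torus.proj L x + t) ω :=
    measurable_set_iff.1 (measurable_restrictConfig _) e
  by_cases he : e ∈ (zdGraph d).edgeSet
  · have : (fun ω : BondConfig (TorusSite d L) =>
        e ∈ restrictConfig (fun x : Site d => Torus.proj L x + t) ω ∩ (zdGraph d).edgeSet) =
        fun ω => e ∈ restrictConfig (fun x : Site d => Torus.proj L x + t) ω := by
      funext ω; simp only [Set.mem_inter_iff, he, and_true]
    rw [this]; exact h1
  · have : (fun ω : BondConfig (TorusSite d L) =>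
        e ∈ restrictConfig (fun x : Site d => Torus.proj L x + t) ω ∩ (zdGraph d).edgeSet) = fun _ => False := by
      funext ω; simp only [Set.mem_inter_iff, he, and_false]
    rw [this]; exact measurable_const

/-! ## §4 Events read at a base point: `Λ_t⁻¹(A)` -/

/-- `Λ_t⁻¹(A)` is increasing when `A` is. [folklore] -/
theorem isUpperSet_preimage_lift (t : TorusSite d L) {A : Set (BondConfig (Site d))} (hA : IsUpperSet A) :
    IsUpperSet ((fun ω : BondConfig (TorusSite d L) =>
      restrictConfig (fun x : Site d => Torus.proj L x + t) ω ∩ (zdGraph d).edgeSet) ⁻¹' A) :=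
  fun _ _ hle hω => hA (lift_mono t hle) hω

/-- `Λ_t⁻¹(A)` is determined by the torus edges (`L ≥ 2`). [folklore] -/
theorem determinedBy_preimage_lift (hL : 2 ≤ L) (t : TorusSite d L) (A : Set (BondConfig (Site d))) :
    DeterminedBy ((fun ω : BondConfig (TorusSite d L) =>
      restrictConfig (fun x : Site d => Torus.proj L x + t) ω ∩ (zdGraph d).edgeSet) ⁻¹' A) (torusGraph d L).edgeSet := by
  rw [determinedBy_iff]
  intro ω ω' hωω'
  simp only [Set.mem_preimage]
  rw [lift_inter_edgeSet hL t ω, lift_inter_edgeSet hL t ω', hωω']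

/-- `Λ_t⁻¹(A)` is measurable when `A` is. [folklore] -/
theorem measurableSet_preimage_lift (t : TorusSite d L) {A : Set (BondConfig (Site d))} (hA : MeasurableSet A) :
    MeasurableSet ((fun ω : BondConfig (TorusSite d L) =>
      restrictConfig (fun x : Site d => Torus.proj L x + t) ω ∩ (zdGraph d).edgeSet) ⁻¹' A) :=
  measurable_lift t hA

/-- **TRANSLATION COVARIANCE OF THE READ-OFF EVENTS**: `{ω_T | ω_T + u ∈ Λ_t⁻¹(A)} = Λ_{t−u}⁻¹(A)`. [folklore] -/
theorem relabel_preimage_preimage_lift (t u : TorusSite d L) (A : Set (BondConfig (Site d))) :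
    BondConfig.relabel (sym2Equiv (torusTranslate u).toEquiv) ⁻¹'
        ((fun ω : BondConfig (TorusSite d L) =>
          restrictConfig (fun x : Site d => Torus.proj L x + t) ω ∩ (zdGraph d).edgeSet) ⁻¹' A) =
      (fun ω : BondConfig (TorusSite d L) =>
          restrictConfig (fun x : Site d => Torus.proj L x + (t - u)) ω ∩ (zdGraph d).edgeSet) ⁻¹' A := by
  ext ω
  simp only [Set.mem_preimage, lift_relabel_torusTranslate]

/-! ## §5 The symmetrised event `⋃_t Λ_t⁻¹(A)` -/

/-- **THE SYMMETRISED EVENT IS TRANSLATION INVARIANT**: `{ω_T | ω_T + u ∈ ⋃_t Λ_t⁻¹(A)} = ⋃_t Λ_t⁻¹(A)` for every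
`u ∈ (ℤ/Lℤ)^d` — the hypothesis of part II. [cite: BollobasRiordan2006, Ch. 3, Lemma 8 (the event "some translate occurs")] -/
theorem relabel_preimage_iUnion_lift (u : TorusSite d L) (A : Set (BondConfig (Site d))) :
    BondConfig.relabel (sym2Equiv (torusTranslate u).toEquiv) ⁻¹'
        (⋃ t : TorusSite d L, (fun ω : BondConfig (TorusSite d L) =>
          restrictConfig (fun x : Site d => Torus.proj L x + t) ω ∩ (zdGraph d).edgeSet) ⁻¹' A) =
      ⋃ t : TorusSite d L, (fun ω : BondConfig (TorusSite d L) =>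
          restrictConfig (fun x : Site d => Torus.proj L x + t) ω ∩ (zdGraph d).edgeSet) ⁻¹' A := by
  rw [Set.preimage_iUnion]
  simp only [relabel_preimage_preimage_lift]
  ext ω
  simp only [Set.mem_iUnion, Set.mem_preimage]
  constructor
  · rintro ⟨t, ht⟩; exact ⟨t - u, ht⟩
  · rintro ⟨t, ht⟩; exact ⟨t + u, by simpa only [add_sub_cancel_right] using ht⟩

/-- The symmetrised event is increasing when `A` is. [folklore] -/
theorem isUpperSet_iUnion_lift {A : Set (BondConfig (Site d))} (hA : IsUpperSet A) :
    IsUpperSet (⋃ t : TorusSite d L, (fun ω : BondConfig (TorusSite d L) =>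
      restrictConfig (fun x : Site d => Torus.proj L x + t) ω ∩ (zdGraph d).edgeSet) ⁻¹' A) := by
  intro ω ω' hle hω
  obtain ⟨t, ht⟩ := Set.mem_iUnion.1 hω
  exact Set.mem_iUnion.2 ⟨t, isUpperSet_preimage_lift t hA hle ht⟩

/-- The symmetrised event is determined by the torus edges (`L ≥ 2`). [folklore] -/
theorem determinedBy_iUnion_lift (hL : 2 ≤ L) (A : Set (BondConfig (Site d))) :
    DeterminedBy (⋃ t : TorusSite d L, (fun ω : BondConfig (TorusSite d L) =>
      restrictConfig (fun x : Site d => Torus.proj L x + t) ω ∩ (zdGraph d).edgeSet) ⁻¹' A) (torusGraph d L).edgeSet :=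
  DeterminedBy.iUnion fun t => determinedBy_preimage_lift hL t A

/-- The symmetrised event is measurable when `A` is (`L ≥ 1`). [folklore] -/
theorem measurableSet_iUnion_lift [NeZero L] {A : Set (BondConfig (Site d))} (hA : MeasurableSet A) :
    MeasurableSet (⋃ t : TorusSite d L, (fun ω : BondConfig (TorusSite d L) =>
      restrictConfig (fun x : Site d => Torus.proj L x + t) ω ∩ (zdGraph d).edgeSet) ⁻¹' A) :=
  MeasurableSet.iUnion fun t => measurableSet_preimage_lift t hA

/-- **MONOTONICITY IN THE BASE POINT SET**: `Λ_{t₀}⁻¹(A) ⊆ ⋃_t Λ_t⁻¹(A)`, so `P(Λ_{t₀}⁻¹(A)) ≤ P(⋃_t Λ_t⁻¹(A))` for every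
measure. [folklore] -/
theorem preimage_lift_subset_iUnion (t₀ : TorusSite d L) (A : Set (BondConfig (Site d))) :
    (fun ω : BondConfig (TorusSite d L) =>
        restrictConfig (fun x : Site d => Torus.proj L x + t₀) ω ∩ (zdGraph d).edgeSet) ⁻¹' A ⊆
      ⋃ t : TorusSite d L, (fun ω : BondConfig (TorusSite d L) =>
        restrictConfig (fun x : Site d => Torus.proj L x + t) ω ∩ (zdGraph d).edgeSet) ⁻¹' A :=
  Set.subset_iUnion (fun t : TorusSite d L => (fun ω : BondConfig (TorusSite d L) =>
    restrictConfig (fun x : Site d => Torus.proj L x + t) ω ∩ (zdGraph d).edgeSet) ⁻¹' A) t₀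

end Summit.CriticalPhenomena.PercolationContinuityZ3.Theorems.Crossing

end
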